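import Summits.KontsevichZagierPeriods.KontsevichZagierPeriods.Theorems.LinRedNormalFormArrangementNormalFormStubRebaseSimpleZeroNestedDiffCTools
import Summits.KontsevichZagierPeriods.KontsevichZagierPeriods.Theorems.LinRedNormalFormArrangementNormalFormStubUnletterDefs

/-!
# Stub `stub_rebaseSimpleZeroTwo`, part `rebaseSimpleZero_nestedDifferent` (crux
`ArrangementNormalForm`, line `janus-bands`) — brick `NestedDiffSigns`

From ABSOLUTE CONVERGENCE to the position of the letters. For a clean nest
`A(y) < tᵢ < tⱼ < B(y)` over a one-dimensional base with the literal `GS 0 2` integrand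
`K/((y − r)(tᵢ − cᵢ(y))(tⱼ − cⱼ(y)))`, `K ≠ 0`:
* `RebaseDiff.letter_ne_of_integrableOn` — if the integrand is absolutely integrable on the (open)
  domain, NO letter plane `t_l = c_l(y)` meets the domain: otherwise the shear
  `t_l ↦ t_l + c_l(y)` (rule-2 calculus of `RebaseDiff.rkMap`, Jacobian `1`) pulls a small box
  back to a coordinate box on which the integrand dominates `κ/|t_l|`, and
  `∫ dt/|t| = ∞` (`unletter_integrableOn_pi`, `intervalIntegrable_inv_iff`);
* `RebaseDiff.segment_mem_nDom`, `RebaseDiff.letter_sign_const`, `RebaseDiff.exists_letter_sign` —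
  the domain is convex and the letter forms are affine, so a non-vanishing letter form has a
  CONSTANT SIGN on the domain.
These discharge the non-vanishing and sign hypotheses of the type-A/B/C theorems of the rebase of
a nested pair with letters of different `y`-slopes. Registered: `rebaseSimpleZero_letterOffDomain`.

References: M. Kontsevich, D. Zagier, *Periods* (2001), §1.2; D. Zagier, *Values of zeta functions
and their applications* (1994), §9.
-/

noncomputable section

open Set MeasureTheory MvPolynomial Metric
open Literature.NumberTheory.Transcendental Literature.ModelTheory.ExponentialFields

namespace Summit.KontsevichZagierPeriods.ArrangementNormalForm.JanusBands

namespace RebaseDiff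

open SeparatePos RebasePos RebaseZero RebaseNest

variable {m' : ℕ} {i j : Fin 2}

/-! ### Convexity and constant signs -/

/-- The letter forms are affine along segments. -/
theorem letter_segment (l : Fin 2) (c : Cf) (z z' : Fin (0 + 1 + 2) → ℝ) (t : ℝ) :
    tv (t • z + (1 - t) • z') l - ev c (yv (t • z + (1 - t) • z')) =
      t * (tv z l - ev c (yv z)) + (1 - t) * (tv z' l - ev c (yv z')) := by
  simp only [tv, yv, ev, Pi.add_apply, Pi.smul_apply, smul_eq_mul]
  ring

/-- A function affine along a segment with opposite strict signs at the ends vanishes inside. -/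
theorem exists_zero_on_segment {φ : (Fin (0 + 1 + 2) → ℝ) → ℝ} {z z' : Fin (0 + 1 + 2) → ℝ}
    (hφ : ∀ t : ℝ, φ (t • z + (1 - t) • z') = t * φ z + (1 - t) * φ z') (hz : 0 < φ z) (hz' : φ z' < 0) :
    ∃ t ∈ Ioo (0 : ℝ) 1, φ (t • z + (1 - t) • z') = 0 := by
  have hd : φ z' - φ z < 0 := by linarith
  have hd' : φ z' - φ z ≠ 0 := hd.ne
  refine ⟨φ z' / (φ z' - φ z), ⟨div_pos_of_neg_of_neg hz' hd, (div_lt_one_of_neg hd).2 (by linarith)⟩, ?_⟩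
  rw [hφ]
  field_simp
  ring

/-- **The clean nest is convex**: open segments between points of the domain lie in it. -/
theorem segment_mem_nDom (hij : i ≠ j) (M : Fin m' → Cf) (A Bd : Cf) {z z' : Fin (0 + 1 + 2) → ℝ}
    (hz : z ∈ gDom 0 2 m' M (nlo i A) (nhi j Bd)) (hz' : z' ∈ gDom 0 2 m' M (nlo i A) (nhi j Bd)) {t : ℝ}
    (ht : t ∈ Ioo (0 : ℝ) 1) : t • z + (1 - t) • z' ∈ gDom 0 2 m' M (nlo i A) (nhi j Bd) := by
  rw [mem_nDom hij] at hz hz' ⊢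
  obtain ⟨h0, h1, h2, h3⟩ := hz
  obtain ⟨h0', h1', h2', h3'⟩ := hz'
  have ht0 : 0 < t := ht.1
  have ht1 : 0 < 1 - t := by linarith [ht.2]
  have hy : yv (t • z + (1 - t) • z') = t * yv z + (1 - t) * yv z' := by
    simp only [yv, Pi.add_apply, Pi.smul_apply, smul_eq_mul]
  have htv : ∀ l, tv (t • z + (1 - t) • z') l = t * tv z l + (1 - t) * tv z' l := fun l => by
    simp only [tv, Pi.add_apply, Pi.smul_apply, smul_eq_mul]
  have hev : ∀ c : Cf, ev c (t * yv z + (1 - t) * yv z') = t * ev c (yv z) + (1 - t) * ev c (yv z') :=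
    fun c => by simp only [ev]; ring
  rw [hy, htv, htv]
  refine ⟨fun k => ?_, ?_, ?_, ?_⟩
  · rw [hev]; nlinarith [h0 k, h0' k]
  · rw [hev]; nlinarith
  · nlinarith
  · rw [hev]; nlinarith

/-- **Constant sign of a non-vanishing letter form on the clean nest.** -/
theorem letter_sign_const (hij : i ≠ j) (M : Fin m' → Cf) (A Bd : Cf) (l : Fin 2) (c : Cf)
    (hne : ∀ z ∈ gDom 0 2 m' M (nlo i A) (nhi j Bd), tv z l ≠ ev c (yv z)) {z z' : Fin (0 + 1 + 2) → ℝ}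
    (hz : z ∈ gDom 0 2 m' M (nlo i A) (nhi j Bd)) (hz' : z' ∈ gDom 0 2 m' M (nlo i A) (nhi j Bd))
    (hpos : 0 < tv z l - ev c (yv z)) : 0 < tv z' l - ev c (yv z') := by
  by_contra h
  have hneg : tv z' l - ev c (yv z') < 0 := lt_of_le_of_ne (not_lt.1 h) (sub_ne_zero.2 (hne z' hz'))
  obtain ⟨t, ht, h0⟩ := exists_zero_on_segment (φ := fun w => tv w l - ev c (yv w))
    (letter_segment l c z z') hpos hneg
  exact hne _ (segment_mem_nDom hij M A Bd hz hz' ht) (sub_eq_zero.1 h0)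

/-- **A uniform sign**: a letter form that does not vanish on the clean nest has a constant
strict sign `ε = ±1` there. -/
theorem exists_letter_sign (hij : i ≠ j) (M : Fin m' → Cf) (A Bd : Cf) (l : Fin 2) (c : Cf)
    (hne : ∀ z ∈ gDom 0 2 m' M (nlo i A) (nhi j Bd), tv z l ≠ ev c (yv z)) :
    ∃ ε : ℝ, (ε = 1 ∨ ε = -1) ∧ ∀ z ∈ gDom 0 2 m' M (nlo i A) (nhi j Bd), 0 < ε * (tv z l - ev c (yv z)) := by
  by_cases hD : ∃ z₀, z₀ ∈ gDom 0 2 m' M (nlo i A) (nhi j Bd)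
  · obtain ⟨z₀, hz₀⟩ := hD
    rcases lt_or_gt_of_ne (sub_ne_zero.2 (hne z₀ hz₀)).symm with h0 | h0
    · refine ⟨1, Or.inl rfl, fun z hz => ?_⟩
      rw [one_mul]
      exact letter_sign_const hij M A Bd l c hne hz₀ hz h0
    · refine ⟨-1, Or.inr rfl, fun z hz => ?_⟩
      have hnot : ¬ (0 < tv z l - ev c (yv z)) := fun hpos =>
        absurd (letter_sign_const hij M A Bd l c hne hz hz₀ hpos) (not_lt.2 h0.le)
      rcases lt_or_gt_of_ne (sub_ne_zero.2 (hne z hz)) with h1 | h1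
      · linarith
      · exact absurd h1 hnot
  · push Not at hD
    exact ⟨1, Or.inl rfl, fun z hz => absurd hz (hD z)⟩

/-! ### The clean nest is open -/

/-- The clean nest is an open set. -/
theorem isOpen_nDom (hij : i ≠ j) (M : Fin m' → Cf) (A Bd : Cf) : IsOpen (gDom 0 2 m' M (nlo i A) (nhi j Bd)) := by
  have hy : Continuous fun z : Fin (0 + 1 + 2) → ℝ => yv z := continuous_apply _
  have ht : ∀ l : Fin 2, Continuous fun z : Fin (0 + 1 + 2) → ℝ => tv z l := fun l => continuous_apply _
  have hev : ∀ c : Cf, Continuous fun z : Fin (0 + 1 + 2) → ℝ => ev c (yv z) := fun c => by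
    simp only [ev]; fun_prop
  have h : gDom 0 2 m' M (nlo i A) (nhi j Bd) = (⋂ k, {z | 0 < ev (M k) (yv z)}) ∩
      ({z | ev A (yv z) < tv z i} ∩ ({z | tv z i < tv z j} ∩ {z | tv z j < ev Bd (yv z)})) := by
    ext z
    rw [mem_nDom hij]
    simp only [cell, mem_inter_iff, mem_iInter, mem_setOf_eq]
  rw [h]
  exact (isOpen_iInter_of_finite fun k => isOpen_lt continuous_const (hev _)).inter
    ((isOpen_lt (hev A) (ht i)).inter ((isOpen_lt (ht i) (ht j)).inter (isOpen_lt (ht j) (hev Bd))))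

/-! ### A letter plane through the domain makes the integrand diverge -/

section Diverge

variable (l : Fin 2) (c : Cf)

/-- Coefficients of the shear `t_l ↦ t_l + c(y)`: the functional `c₁ y`. -/
def coefS (c : Cf) : Fin (0 + 1 + 2) → ℚ := Function.update 0 (yIdx 2) (c.1 (Fin.last 0))

/-- The functional of the shear. -/
theorem rkSumS (w : Fin (0 + 1 + 2) → ℝ) : ∑ k, (coefS c k : ℝ) * w k = (c.1 (Fin.last 0) : ℝ) * yv w := by
  have h : ∀ k, (coefS c k : ℝ) * w k = if k = yIdx 2 then (c.1 (Fin.last 0) : ℝ) * w k else 0 := fun k => by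
    by_cases hk : k = yIdx 2
    · subst hk; simp [coefS]
    · simp [coefS, hk]
  simp only [h, Finset.sum_ite_eq', Finset.mem_univ, if_true]
  rfl

/-- The Jacobian number of the shear is `1`. -/
theorem rkJac_S : rkJac (coefS c) (xR l) = 1 := by
  have h : ∑ k, coefS c k * xR l k = coefS c (tIdx l) := by
    simp only [xR, Pi.single_apply, mul_ite, mul_one, mul_zero, Finset.sum_ite_eq', Finset.mem_univ, if_true]
  rw [rkJac, h, coefS, Function.update_of_ne (yIdx_ne_tIdx l).symm]
  simp

/-- The shear on the sheared fibre. -/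
theorem tv_shear_self (w : Fin (0 + 1 + 2) → ℝ) : tv (rkMap (coefS c) (xR l) c.2 w) l = tv w l + ev c (yv w) := by
  show rkMap (coefS c) (xR l) c.2 w (tIdx l) = _
  rw [rkMap_apply, rkSumS, ev]
  simp only [xR, Pi.single_eq_same, Rat.cast_one, mul_one]
  rfl

/-- The shear fixes the other fibre. -/
theorem tv_shear_other {l' : Fin 2} (h : l' ≠ l) (w : Fin (0 + 1 + 2) → ℝ) :
    tv (rkMap (coefS c) (xR l) c.2 w) l' = tv w l' := by
  show rkMap (coefS c) (xR l) c.2 w (tIdx l') = _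
  rw [rkMap_apply]
  simp only [xR, Pi.single_eq_of_ne (tIdx_injective.ne h), Rat.cast_zero, mul_zero, add_zero]
  rfl

/-- The shear fixes the base. -/
theorem yv_shear (w : Fin (0 + 1 + 2) → ℝ) : yv (rkMap (coefS c) (xR l) c.2 w) = yv w := by
  show rkMap (coefS c) (xR l) c.2 w (yIdx 2) = _
  rw [rkMap_apply]
  simp only [xR, Pi.single_eq_of_ne (yIdx_ne_tIdx l), Rat.cast_zero, mul_zero, add_zero]
  rfl

/-- `x ↦ |x|⁻¹` is not integrable around `0`. -/
theorem not_integrableOn_abs_inv {δ : ℝ} (hδ : 0 < δ) : ¬ IntegrableOn (fun x : ℝ => |x|⁻¹) (Ioo (-δ) δ) := by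
  intro h
  have hle : -δ ≤ δ := by linarith
  have h4 : IntervalIntegrable (fun x : ℝ => x⁻¹) volume (-δ) δ := by
    rw [intervalIntegrable_iff_integrableOn_Ioo_of_le hle]
    refine (integrable_norm_iff (measurable_inv.aestronglyMeasurable)).1 ?_
    have e : (fun x : ℝ => ‖x⁻¹‖) = fun x => |x|⁻¹ := by ext x; simp [Real.norm_eq_abs]
    rw [e]; exact h
  rcases intervalIntegrable_inv_iff.1 h4 with h' | h'
  · linarith
  · exact h' (by rw [uIcc_of_le hle]; exact ⟨by linarith, hδ.le⟩)

/-- **Core of the divergence.** If `f = K · (y − r)⁻¹ (t_l − c(y))⁻¹ (t_{l'} − c'(y))⁻¹` with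
`K ≠ 0` is absolutely integrable on an open set `D`, the plane `t_l = c(y)` does not meet `D`. -/
theorem letter_ne_of_integrableOn_core {l' : Fin 2} (hll : l ≠ l') (c' : Cf) (K : ℝ) (hK : K ≠ 0) (r : ℚ)
    {D : Set (Fin (0 + 1 + 2) → ℝ)} (hD : IsOpen D) {f : (Fin (0 + 1 + 2) → ℝ) → ℝ}
    (hf : ∀ z, f z = K * (1 / (yv z - r)) * ((1 / (tv z l - ev c (yv z))) * (1 / (tv z l' - ev c' (yv z)))))
    (hint : IntegrableOn f D) : ∀ z ∈ D, tv z l ≠ ev c (yv z) := by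
  intro z₀ hz₀ heq
  -- a box around the sheared centre mapping into a ball of `D`
  obtain ⟨ε, hε, hball⟩ := Metric.isOpen_iff.1 hD z₀ hz₀
  set lam : ℝ := (c.1 (Fin.last 0) : ℝ) with hlam
  set δ : ℝ := ε / (2 * (1 + |lam|)) with hδdef
  have hL : 0 < 1 + |lam| := by positivity
  have hδ : 0 < δ := by rw [hδdef]; positivity
  have hδε : (1 + |lam|) * δ = ε / 2 := by rw [hδdef]; field_simp
  have hδle : δ ≤ ε / 2 := by nlinarith [abs_nonneg lam, hδ.le]
  set ctr : Fin (0 + 1 + 2) → ℝ := Function.update z₀ (tIdx l) 0 with hctr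
  set I : Fin (0 + 1 + 2) → Set ℝ := fun k => Ioo (ctr k - δ) (ctr k + δ) with hI
  set S : Set (Fin (0 + 1 + 2) → ℝ) := Set.pi univ I with hS
  set Φ := rkMap (coefS c) (xR l) c.2 with hΦ
  have hSm : MeasurableSet S := MeasurableSet.univ_pi fun _ => measurableSet_Ioo
  have hmemS : ∀ w ∈ S, |yv w - yv z₀| < δ ∧ |tv w l| < δ ∧ |tv w l' - tv z₀ l'| < δ := fun w hw => by
    simp only [hS, hI, mem_pi, mem_univ, true_imp_iff, mem_Ioo] at hw
    have hy := hw (yIdx 2)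
    have hl := hw (tIdx l)
    have hl' := hw (tIdx l')
    rw [hctr, Function.update_of_ne (yIdx_ne_tIdx l)] at hy
    rw [hctr, Function.update_self] at hl
    rw [hctr, Function.update_of_ne (tIdx_injective.ne hll.symm)] at hl'
    exact ⟨abs_lt.2 ⟨by simp only [yv]; linarith, by simp only [yv]; linarith⟩,
      abs_lt.2 ⟨by simp only [tv]; linarith, by simp only [tv]; linarith⟩,
      abs_lt.2 ⟨by simp only [tv]; linarith, by simp only [tv]; linarith⟩⟩
  have hΦD : ∀ w ∈ S, Φ w ∈ D := fun w hw => by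
    obtain ⟨hy, hl, hl'⟩ := hmemS w hw
    refine hball (mem_ball.2 ((dist_pi_lt_iff hε).2 fun k => ?_))
    rw [Real.dist_eq]
    rcases idx_cases k with rfl | ⟨q, rfl⟩
    · change |yv (Φ w) - yv z₀| < ε
      rw [yv_shear]
      have := (abs_lt.1 hy).1; have := (abs_lt.1 hy).2
      exact abs_lt.2 ⟨by linarith, by linarith⟩
    · rcases fin_two_eq_or hll q with hq | hq <;> rw [hq]
      · change |tv (Φ w) l - tv z₀ l| < ε
        rw [tv_shear_self, heq]
        have : ev c (yv w) - ev c (yv z₀) = lam * (yv w - yv z₀) := by simp only [ev, hlam]; ring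
        calc |tv w l + ev c (yv w) - ev c (yv z₀)| = |tv w l + lam * (yv w - yv z₀)| := by rw [add_sub_assoc, this]
          _ ≤ |tv w l| + |lam * (yv w - yv z₀)| := abs_add_le _ _
          _ = |tv w l| + |lam| * |yv w - yv z₀| := by rw [abs_mul]
          _ < δ + |lam| * δ := add_lt_add_of_lt_of_le hl (mul_le_mul_of_nonneg_left hy.le (abs_nonneg _))
          _ = (1 + |lam|) * δ := by ring
          _ < ε := by rw [hδε]; linarith
      · change |tv (Φ w) l' - tv z₀ l'| < ε
        rw [tv_shear_other l c hll.symm]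
        have := (abs_lt.1 hl').1; have := (abs_lt.1 hl').2
        exact abs_lt.2 ⟨by linarith, by linarith⟩
  -- rule (2): pull back to the box
  have hintS : IntegrableOn (fun w => |(rkLin (coefS c) (xR l)).det| • f (Φ w)) S :=
    (integrableOn_image_iff_integrableOn_abs_det_fderiv_smul volume hSm
      (fun w _ => (hasFDerivAt_rkMap (coefS c) (xR l) c.2 w).hasFDerivWithinAt)
      (rkMap_injective (coefS c) (xR l) c.2 (by rw [rkJac_S]; exact one_ne_zero)).injOn f).1
      (hint.mono_set (by rintro _ ⟨w, hw, rfl⟩; exact hΦD w hw))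
  have hdet : |(rkLin (coefS c) (xR l)).det| = 1 := by rw [rkLin_det, rkJac_S]; simp
  simp only [hdet, one_smul] at hintS
  -- the a.e. lower bound `κ/|t_l| ≤ |f ∘ Φ|` on the box
  set Cy : ℝ := |yv z₀| + δ + |(r : ℝ)| with hCy
  set C₁ : ℝ := |tv z₀ l'| + δ + (|(c'.1 (Fin.last 0) : ℝ)| * (|yv z₀| + δ) + |(c'.2 : ℝ)|) with hC₁
  have hCy0 : 0 < Cy := by positivity
  have hC₁0 : 0 < C₁ := by positivity
  set κ : ℝ := |K| / (Cy * C₁) with hκ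
  have hκ0 : 0 < κ := by rw [hκ]; exact div_pos (abs_pos.2 hK) (mul_pos hCy0 hC₁0)
  have hae : ∀ᵐ w ∂(volume.restrict S), ‖(|w (tIdx l)|)⁻¹‖ ≤ κ⁻¹ * ‖f (Φ w)‖ := by
    have hN₁ : ∀ᵐ w : Fin (0 + 1 + 2) → ℝ, w (yIdx 2) ≠ (r : ℝ) := by
      have := Measure.ae_eval_ne (fun _ : Fin (0 + 1 + 2) => (volume : Measure ℝ)) (yIdx 2) (r : ℝ)
      rwa [← volume_pi] at this
    have hN₂ : ∀ᵐ w : Fin (0 + 1 + 2) → ℝ, w ∉ {z : Fin (0 + 1 + 2) → ℝ | z (Fin.natAdd (0 + 1) l') = affF 0 2 c' z} :=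
      compl_mem_ae_iff.2 (volume_fibre_eq_affF l' c')
    filter_upwards [ae_restrict_mem hSm, ae_restrict_of_ae hN₁, ae_restrict_of_ae hN₂] with w hw hwr hw'
    rw [affF_eq] at hw'
    change tv w l' ≠ ev c' (yv w) at hw'
    change yv w ≠ r at hwr
    obtain ⟨hy, -, hl'⟩ := hmemS w hw
    rw [Real.norm_eq_abs, Real.norm_eq_abs, abs_inv, abs_abs, hf, yv_shear, tv_shear_self,
      tv_shear_other l c hll.symm, add_sub_cancel_right]
    -- bounds on the two harmless factors
    have hb1 : |yv w - r| ≤ Cy := by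
      calc |yv w - r| ≤ |yv w| + |(r : ℝ)| := abs_sub _ _
        _ ≤ |yv z₀| + δ + |(r : ℝ)| := by linarith [abs_sub_abs_le_abs_sub (yv w) (yv z₀)]
    have hb2 : |tv w l' - ev c' (yv w)| ≤ C₁ := by
      have h1 : |tv w l'| ≤ |tv z₀ l'| + δ := by linarith [abs_sub_abs_le_abs_sub (tv w l') (tv z₀ l')]
      have h2 : |yv w| ≤ |yv z₀| + δ := by linarith [abs_sub_abs_le_abs_sub (yv w) (yv z₀)]
      have h3 : |ev c' (yv w)| ≤ |(c'.1 (Fin.last 0) : ℝ)| * (|yv z₀| + δ) + |(c'.2 : ℝ)| := by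
        rw [ev]
        calc |(c'.1 (Fin.last 0) : ℝ) * yv w + c'.2| ≤ |(c'.1 (Fin.last 0) : ℝ) * yv w| + |(c'.2 : ℝ)| :=
              abs_add_le _ _
          _ = |(c'.1 (Fin.last 0) : ℝ)| * |yv w| + |(c'.2 : ℝ)| := by rw [abs_mul]
          _ ≤ |(c'.1 (Fin.last 0) : ℝ)| * (|yv z₀| + δ) + |(c'.2 : ℝ)| := by
              nlinarith [abs_nonneg (c'.1 (Fin.last 0) : ℝ),
                mul_le_mul_of_nonneg_left h2 (abs_nonneg (c'.1 (Fin.last 0) : ℝ))]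
      calc |tv w l' - ev c' (yv w)| ≤ |tv w l'| + |ev c' (yv w)| := abs_sub _ _
        _ ≤ C₁ := by rw [hC₁]; linarith
    have hp1 : 0 < |yv w - r| := abs_pos.2 (sub_ne_zero.2 hwr)
    have hp2 : 0 < |tv w l' - ev c' (yv w)| := abs_pos.2 (sub_ne_zero.2 hw')
    by_cases h0 : tv w l = 0
    · have : (|w (tIdx l)|)⁻¹ = 0 := by change (|tv w l|)⁻¹ = 0; rw [h0, abs_zero, inv_zero]
      rw [this]; positivity
    have hp0 : 0 < |tv w l| := abs_pos.2 h0
    rw [abs_mul, abs_mul, abs_mul, abs_div, abs_div, abs_div, abs_one]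
    have h3 : 1 ≤ Cy / |yv w - ↑r| := (one_le_div hp1).2 hb1
    have h4 : 1 ≤ C₁ / |tv w l' - ev c' (yv w)| := (one_le_div hp2).2 hb2
    have h34 := one_le_mul_of_one_le_of_one_le h3 h4
    have hK' : |K| ≠ 0 := abs_ne_zero.2 hK
    calc (|tv w l|)⁻¹ = 1 * (|tv w l|)⁻¹ := (one_mul _).symm
      _ ≤ (Cy / |yv w - ↑r| * (C₁ / |tv w l' - ev c' (yv w)|)) * (|tv w l|)⁻¹ :=
          mul_le_mul_of_nonneg_right h34 (inv_nonneg.2 (abs_nonneg _))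
      _ = κ⁻¹ * (|K| * (1 / |yv w - ↑r|) * (1 / |tv w l| * (1 / |tv w l' - ev c' (yv w)|))) := by
          rw [hκ]; field_simp
  have hm1 : Measurable fun x : ℝ => (|x|)⁻¹ := continuous_abs.measurable.inv
  have h2 : IntegrableOn (fun w : Fin (0 + 1 + 2) → ℝ => (|w (tIdx l)|)⁻¹) S :=
    Integrable.mono' (hintS.norm.const_mul _) (hm1.comp (measurable_pi_apply _)).aestronglyMeasurable hae
  -- down to one variable
  have h3 : IntegrableOn (fun x : ℝ => (|x|)⁻¹) (I (tIdx l)) := by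
    refine unletter_integrableOn_pi _ I (tIdx l) _ hm1 (fun k => ?_) (fun k => ?_) h2
    · simp only [hI, Real.volume_Ioo]; rw [ENNReal.ofReal_ne_zero_iff]; linarith
    · simp only [hI, Real.volume_Ioo]; exact ENNReal.ofReal_ne_top
  have hI0 : I (tIdx l) = Ioo (-δ) δ := by
    simp only [hI, hctr, Function.update_self, zero_sub, zero_add]
  rw [hI0] at h3
  exact not_integrableOn_abs_inv hδ h3

end Diverge

variable {m : ℕ}

/-- **Absolute convergence keeps the letters off the domain.** If the literal `GS 0 2` integrand of
a clean nest with two lettered fibres, a simple base pole and a non-zero base constant is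
absolutely integrable on the domain, neither letter plane `t_l = c_l(y)` meets the domain.
[Zagier 1994, §9] -/
theorem letter_ne_of_integrableOn (hij : i ≠ j) (M : Fin m' → Cf) (A Bd : Cf) (T : BData)
    (p : MvPolynomial (Fin 0) ℚ) (a : Fin 2 → Option Cf) (ci cj : Cf) (hi : a i = some ci) (hj : a j = some cj)
    (h1 : T.n₁ = 0) (hn : T.n₂ = 1) (hK : Kc T p ≠ 0)
    (hint : IntegrableOn (glitB T p a) (gDom 0 2 m' M (nlo i A) (nhi j Bd))) :
    (∀ z ∈ gDom 0 2 m' M (nlo i A) (nhi j Bd), tv z i ≠ ev ci (yv z)) ∧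
      (∀ z ∈ gDom 0 2 m' M (nlo i A) (nhi j Bd), tv z j ≠ ev cj (yv z)) :=
  ⟨letter_ne_of_integrableOn_core i ci hij cj (Kc T p) hK T.ℓ₂.2 (isOpen_nDom hij M A Bd)
      (glitB_two T p a hij ci cj hi hj h1 hn) hint,
    letter_ne_of_integrableOn_core j cj hij.symm ci (Kc T p) hK T.ℓ₂.2 (isOpen_nDom hij M A Bd)
      (fun z => by rw [glitB_two T p a hij ci cj hi hj h1 hn, mul_comm (1 / (tv z i - _))]) hint⟩

end RebaseDiff

/-- **Registered brick `rebaseSimpleZero_letterOffDomain` of the part `rebaseSimpleZero_nestedDifferent`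
(stub `stub_rebaseSimpleZeroTwo`, line `janus-bands`).** For a clean nest `A(y) < tᵢ < tⱼ < B(y)`
(literal `GS 0 2` datum, simple base pole, both fibres lettered) whose literal integrand has a
non-zero base constant and is absolutely integrable on the domain, neither letter plane
`t_l = c_l(y)` meets the domain (`RebaseDiff.letter_ne_of_integrableOn`: a box around a point of
the plane is sheared to a coordinate box on which the integrand dominates `κ/|t_l|`, and
`∫ dt/|t| = ∞`). [Zagier 1994, §9] -/
theorem rebaseSimpleZero_letterOffDomain (m' : ℕ) (i j : Fin 2) (hij : i ≠ j) (M : Fin m' → (Fin (0 + 1) → ℚ) × ℚ) (A Bd : (Fin (0 + 1) → ℚ) × ℚ) (T : RebaseZero.BData) (p : MvPolynomial (Fin 0) ℚ) (a : Fin 2 → Option ((Fin (0 + 1) → ℚ) × ℚ)) (ci cj : (Fin (0 + 1) → ℚ) × ℚ) (hi : a i = some ci) (hj : a j = some cj) (h1 : T.n₁ = 0) (hn : T.n₂ = 1) (hK : RebaseDiff.Kc T p ≠ 0) (hint : MeasureTheory.IntegrableOn (RebaseZero.glitB T p a) (SeparatePos.gDom 0 2 m' M (RebaseNest.nlo i A)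 (RebaseNest.nhi j Bd))) : (∀ z ∈ SeparatePos.gDom 0 2 m' M (RebaseNest.nlo i A) (RebaseNest.nhi j Bd), RebaseZero.tv z i ≠ RebaseZero.ev ci (RebaseZero.yv z)) ∧ (∀ z ∈ SeparatePos.gDom 0 2 m' M (RebaseNest.nlo i A) (RebaseNest.nhi j Bd), RebaseZero.tv z j ≠ RebaseZero.ev cj (RebaseZero.yv z)) :=
  RebaseDiff.letter_ne_of_integrableOn hij M A Bd T p a ci cj hi hj h1 hn hK hint

end Summit.KontsevichZagierPeriods.ArrangementNormalForm.JanusBands
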